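import Summits.ResolutionOfSingularities.ResolutionOfSingularities.Theorems.SubfieldContactAbs
import Literature.AlgebraicGeometry.Resolution.BlowupStalkCharts
import Literature.AlgebraicGeometry.Resolution.BlowupChartRsop
import Literature.AlgebraicGeometry.Resolution.ColonIdealSheafFG
import Literature.AlgebraicGeometry.Resolution.SymbolicPowersRsop
import Literature.AlgebraicGeometry.Resolution.RegularSubschemeLocallyIrreducible
import Literature.AlgebraicGeometry.Resolution.GenericPointStalkData
import Literature.AlgebraicGeometry.Resolution.DifferentialOperators
import HarnessLib

/-!
# TwistCutOperators — decomp-res node «TwistCut» (lens-6 g21, critic row 159), tree file 1/3 of the node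

Content VERBATIM from the decomp-res lens-6 g21 node `HOME/decomp-res-lens-6/g21/TwistCut.lean` (pin facffb9d, 779 l;
HOME = run/shared/lean/pub/decomp-res; node farm rc 0 · 0 warn · 0 sorry · standard axioms; imports TREE ONLY:
`Theorems.SubfieldContactAbs` +
seven `Literature/AlgebraicGeometry/Resolution` modules; ONE namespace `…Theorems.TwistCutClasses`; no carried
block).  Critic: CRITIC-LEDGER
row 159 (2026-08-31T00:42:09Z): DECIDED-MOD-PORT(M+) +1 · MAP 0 — THE TWIST LAW in kernel on a typed sub-cell of
`E1TopNoAbs` (item 26971), own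
axis; the twisted-Fermat inhabitant decided; residual certificates incl. the sharp TAME near point; port
`WildPointElimination` honest bookkeeping.
Landing order INBOX :591 (critic) / NODE-g21 §6 (lens-6): `--kind proof --supports
stmt-ResolutionOfSingularities-26971`, canonical headers,
three files `TwistCutOperators` (§1–§5: the symbolic-power order law for differential operators, commutator algebra,
transport along ring isos,
coefficient operators on polynomial rings, chart algebra) · `TwistCutLaw` (§6–§7: the three algebraic steps and THE TWIST LAW
`not_near_of_diffSplit` at scheme level) · `TwistCutCells` (§8–§9: the cells `DiffSplitAt` / `NoNearPointOver` /
`TopNonSplit` / `WORTopNonSplit` /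
`WORTopOnlySplit` / `E1TopNonSplit` / `E1TopOnlySplit`, the EXACT carve `e1TopNoAbs_iff_nonSplit_onlySplit`, the
port `WildPointElimination`, the
decided chain `worTopOnlySplit_of_allAbs_of_elimination` / `e1TopNoAbs_iff_e1TopNonSplit(_of_five)` /
`e_one_of_nonSplit`, and the field-level
inhabitant certificates).  Aside bookkeeping (row 159 / INBOX :591): on the lens-6 column ONE port item
`WildPointElimination` (∀ n ≥ 1) and ONE
successor aside `E1TopNonSplit` SUPERSEDING `E1TopNoAbs` (26971) with the mod-port reading; the decided cell
`E1TopOnlySplit` is not filed.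
The lens-6 rev1 companion `TwistCutElim.lean` (868dfb91; the port discharged modulo `BaseStable` ∧
`WildSplitFinite`) awaits the critic.

## This file

§1–§5 (KERNEL, pure commutative algebra): §1 the ORDER LAW AT A PRIME `IsDiffOpLE.apply_mem_of_mul_mem_pow` (an
operator of order `≤ k` maps the symbolic power `𝔫^{(k+1)}` into `𝔫`) and its corollaries; §2 commutator algebra; §3
transport of absolute operators (base `ℤ`) along a ring isomorphism (`conj`); §4 coefficient operators `coeffOp` on
polynomial rings (order kept); §5 chart algebra (`monProd`, chart powers — generic target ring).  Imports = the lens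
imports (tree `SubfieldContactAbs` + Literature).

[WRITER NOTE (decomp-res writer g9): file split only (tree files ≤ 400 lines); namespace, universe, sections,
section variables / opens and
every declaration exactly as in the lens; the only edits are DOCSTRING-ONLY: kind tags on `E1TopNonSplit` /
`E1TopOnlySplit` (INBOX :591), a docstring for `polyChartEquiv`, and the
lens's global dupNamespace-linter line dropped (no duplicate namespace component in the tree file names).]

(Sources: EGAIV4 16.8.2, 16.8.8; Matsumura1987 §26, Thm 30.6; Villamayor2008 Def. 3.3 (arXiv:math/0606796);
BenitoVillamayor2012 (arXiv:1004.1803); BGMW §3.1; CossartJannsenSaito2020 Def. 3.13, §4, Thm 1.4;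
CossartPiltant2019; Giraud1975; Hironaka1970Additive; Moh1987.)
-/

noncomputable section

open CategoryTheory AlgebraicGeometry TopologicalSpace IsLocalRing
open Literature.AlgebraicGeometry.Resolution

universe u

namespace Summit.ResolutionOfSingularities.ResolutionOfSingularities.Theorems.TwistCutClasses

section Law

variable {R₀ : Type*} {A : Type*} [CommSemiring R₀] [CommRing A] [Algebra R₀ A]

/-! ## §1 The symbolic-power law for differential operators -/

/-- **THE ORDER LAW AT A PRIME (kernel)**: an operator of order `≤ k` maps the symbolic power `𝔫^{(k+1)}` into `𝔫`:
if `s ∉ 𝔫`, `s * F ∈ 𝔫 ^ N` with `k < N`, then `D F ∈ 𝔫`. [folklore; EGAIV4 16.8.8, Villamayor 2008 Def. 3.3] [folklore] -/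
theorem IsDiffOpLE.apply_mem_of_mul_mem_pow (𝔫 : Ideal A) [𝔫.IsPrime] :
    ∀ (k : ℕ) {N : ℕ}, k < N → ∀ {D : A →ₗ[R₀] A}, IsDiffOpLE R₀ k D →
      ∀ {s F : A}, s ∉ 𝔫 → s * F ∈ 𝔫 ^ N → D F ∈ 𝔫
  | 0, N, hkN, D, hD, s, F, hs, hsF => by
    have h1 : D (s * F) ∈ 𝔫 ^ (N - 0) := IsDiffOpLE.apply_mem_pow_sub 𝔫 N hD hsF
    have h2 : D (s * F) = s * D F := by
      have := congrArg (fun E : A →ₗ[R₀] A => E F) (hD s)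
      simp only [commMul_apply, LinearMap.zero_apply] at this
      exact sub_eq_zero.mp this
    rw [h2] at h1
    have h3 : s * D F ∈ 𝔫 := Ideal.pow_le_self (by omega) h1
    exact ((Ideal.IsPrime.mem_or_mem inferInstance h3).resolve_left hs)
  | k + 1, N, hkN, D, hD, s, F, hs, hsF => by
    have h1 : D (s * F) ∈ 𝔫 ^ (N - (k + 1)) := IsDiffOpLE.apply_mem_pow_sub 𝔫 N hD hsF
    have h1' : D (s * F) ∈ 𝔫 := Ideal.pow_le_self (by omega) h1
    have h2 : commMul R₀ D s F ∈ 𝔫 :=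
      IsDiffOpLE.apply_mem_of_mul_mem_pow 𝔫 k (by omega) (hD s) hs hsF
    have h3 : s * D F = D (s * F) - commMul R₀ D s F := by
      rw [commMul_apply]; ring
    have h4 : s * D F ∈ 𝔫 := by rw [h3]; exact sub_mem h1' h2
    exact ((Ideal.IsPrime.mem_or_mem inferInstance h4).resolve_left hs)

/-- Corollary: no operator of order `< N` takes an element of the symbolic power `𝔫^{(N)}` to `1`. [folklore] -/
theorem IsDiffOpLE.apply_ne_one_of_mul_mem_pow (𝔫 : Ideal A) [𝔫.IsPrime] {k N : ℕ} (hkN : k < N)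
    {D : A →ₗ[R₀] A} (hD : IsDiffOpLE R₀ k D) {s F : A} (hs : s ∉ 𝔫) (hsF : s * F ∈ 𝔫 ^ N) : D F ≠ 1 := by
  intro h1
  have := IsDiffOpLE.apply_mem_of_mul_mem_pow 𝔫 k hkN hD hs hsF
  rw [h1] at this
  exact Ideal.IsPrime.ne_top inferInstance ((Ideal.eq_top_iff_one 𝔫).mpr this)

end Law

section Comm

variable {R₀ : Type*} {A : Type*} [CommSemiring R₀] [CommRing A] [Algebra R₀ A]

/-! ## §2 Commutator algebra -/

/-- `commMul_add_right`: Auxiliary step of this node's calculus, VERBATIM from the lens file (see the module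
docstring); the statement is its type. [folklore] -/
theorem commMul_add_right (D : A →ₗ[R₀] A) (a b : A) :
    commMul R₀ D (a + b) = commMul R₀ D a + commMul R₀ D b := by
  ext t; simp only [commMul_apply, LinearMap.add_apply, add_mul, map_add]; ring

/-- `commMul_mul_right`: Auxiliary step of this node's calculus, VERBATIM from the lens file (see the module
docstring); the statement is its type. [folklore] -/
theorem commMul_mul_right (D : A →ₗ[R₀] A) (a b : A) :
    commMul R₀ D (a * b) = commMul R₀ D a ∘ₗ LinearMap.mulLeft R₀ b + LinearMap.mulLeft R₀ a ∘ₗ commMul R₀ D b := by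
  ext t
  simp only [commMul_apply, LinearMap.add_apply, LinearMap.comp_apply, LinearMap.mulLeft_apply]
  ring_nf

end Comm

section Transport

variable {A B : Type*} [CommRing A] [CommRing B]

/-! ## §3 Transport of operators along a ring isomorphism (absolute operators, base `ℤ`) -/

/-- Conjugate of a `ℤ`-linear endomorphism of `A` by a ring isomorphism `e : A ≃+* B`. -/
def conj (e : A ≃+* B) (D : A →ₗ[ℤ] A) : B →ₗ[ℤ] B :=
  e.toAddEquiv.toIntLinearEquiv.toLinearMap ∘ₗ D ∘ₗ e.symm.toAddEquiv.toIntLinearEquiv.toLinearMap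

/-- `conj_apply`: Auxiliary step of this node's calculus, VERBATIM from the lens file (see the module docstring);
the statement is its type. [folklore] -/
@[simp] theorem conj_apply (e : A ≃+* B) (D : A →ₗ[ℤ] A) (b : B) : conj e D b = e (D (e.symm b)) := rfl

/-- `commMul_conj`: Auxiliary step of this node's calculus, VERBATIM from the lens file (see the module docstring);
the statement is its type. [folklore] -/
theorem commMul_conj (e : A ≃+* B) (D : A →ₗ[ℤ] A) (b : B) :
    commMul ℤ (conj e D) b = conj e (commMul ℤ D (e.symm b)) := by
  ext t
  simp only [commMul_apply, conj_apply, map_mul, RingEquiv.apply_symm_apply, map_sub]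

/-- `IsDiffOpLE.conj`: Auxiliary step of this node's calculus, VERBATIM from the lens file (see the module
docstring); the statement is its type. [folklore] -/
theorem IsDiffOpLE.conj (e : A ≃+* B) : ∀ {k : ℕ} {D : A →ₗ[ℤ] A}, IsDiffOpLE ℤ k D → IsDiffOpLE ℤ k (conj e D)
  | 0, D, hD => by
    intro b
    rw [commMul_conj, hD (e.symm b)]
    ext t; simp
  | k + 1, D, hD => by
    intro b
    rw [commMul_conj]
    exact IsDiffOpLE.conj e (hD (e.symm b))

end Transport

section Coeff

variable {K : Type*} [CommRing K] {σ : Type*}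

/-! ## §4 Coefficient operators on polynomial rings -/

/-- The coefficientwise extension `δ ⊗ id` of an additive endomorphism `δ` of `K` to `K[T_σ]`. -/
def coeffOp (δ : K →ₗ[ℤ] K) : MvPolynomial σ K →ₗ[ℤ] MvPolynomial σ K :=
  (((AddMonoidAlgebra.coeffAddEquiv (R := K) (M := σ →₀ ℕ)).symm.toAddMonoidHom.comp
    ((Finsupp.mapRange.addMonoidHom δ.toAddMonoidHom).comp
      (AddMonoidAlgebra.coeffAddEquiv (R := K) (M := σ →₀ ℕ)).toAddMonoidHom)).toIntLinearMap :
    AddMonoidAlgebra K (σ →₀ ℕ) →ₗ[ℤ] AddMonoidAlgebra K (σ →₀ ℕ))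

/-- `coeffOp_monomial`: Auxiliary step of this node's calculus, VERBATIM from the lens file (see the module
docstring); the statement is its type. [folklore] -/
@[simp] theorem coeffOp_monomial (δ : K →ₗ[ℤ] K) (s : σ →₀ ℕ) (a : K) :
    coeffOp δ (MvPolynomial.monomial s a) = MvPolynomial.monomial s (δ a) := by
  rw [← MvPolynomial.single_eq_monomial, ← MvPolynomial.single_eq_monomial]
  simp only [coeffOp, AddMonoidHom.coe_toIntLinearMap, AddMonoidHom.coe_comp, Function.comp_apply,
    AddEquiv.coe_toAddMonoidHom, AddMonoidAlgebra.coeffAddEquiv_apply, AddMonoidAlgebra.coeffAddEquiv_symm_apply,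
    Finsupp.mapRange.addMonoidHom_apply, AddMonoidAlgebra.coeff_single, LinearMap.toAddMonoidHom_coe,
    Finsupp.mapRange_single, AddMonoidAlgebra.ofCoeff_single]

/-- `coeffOp_mul_monomial_one`: Auxiliary step of this node's calculus, VERBATIM from the lens file (see the module
docstring); the statement is its type. [folklore] -/
theorem coeffOp_mul_monomial_one (δ : K →ₗ[ℤ] K) (p : MvPolynomial σ K) (s : σ →₀ ℕ) :
    coeffOp δ (p * MvPolynomial.monomial s 1) = coeffOp δ p * MvPolynomial.monomial s 1 := by
  induction p using MvPolynomial.induction_on' with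
  | monomial m a =>
    rw [MvPolynomial.monomial_mul, coeffOp_monomial, coeffOp_monomial, MvPolynomial.monomial_mul, mul_one, mul_one]
  | add p q hp hq => rw [add_mul, map_add, map_add, add_mul, hp, hq]

/-- `coeffOp_C_mul`: Auxiliary step of this node's calculus, VERBATIM from the lens file (see the module docstring);
the statement is its type. [folklore] -/
theorem coeffOp_C_mul (δ : K →ₗ[ℤ] K) (a : K) (p : MvPolynomial σ K) :
    coeffOp δ (MvPolynomial.C a * p) - MvPolynomial.C a * coeffOp δ p = coeffOp (commMul ℤ δ a) p := by
  induction p using MvPolynomial.induction_on' with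
  | monomial m b =>
    rw [MvPolynomial.C_mul_monomial, coeffOp_monomial, coeffOp_monomial, coeffOp_monomial, MvPolynomial.C_mul_monomial,
      commMul_apply, ← map_sub]
  | add p q hp hq => rw [mul_add, map_add, map_add, map_add, mul_add, ← hp, ← hq]; ring

/-- `commMul_coeffOp_monomial_one`: Auxiliary step of this node's calculus, VERBATIM from the lens file (see the
module docstring); the statement is its type. [folklore] -/
theorem commMul_coeffOp_monomial_one (δ : K →ₗ[ℤ] K) (s : σ →₀ ℕ) :
    commMul ℤ (coeffOp δ) (MvPolynomial.monomial s (1 : K)) = 0 := by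
  refine LinearMap.ext fun t => ?_
  rw [commMul_apply, LinearMap.zero_apply, mul_comm, coeffOp_mul_monomial_one, mul_comm, sub_self]

/-- `commMul_coeffOp_C`: Auxiliary step of this node's calculus, VERBATIM from the lens file (see the module
docstring); the statement is its type. [folklore] -/
theorem commMul_coeffOp_C (δ : K →ₗ[ℤ] K) (a : K) :
    commMul ℤ (coeffOp δ) (MvPolynomial.C a : MvPolynomial σ K) = coeffOp (commMul ℤ δ a) := by
  refine LinearMap.ext fun t => ?_
  rw [commMul_apply, coeffOp_C_mul]

/-- An order-`0` coefficient operator is order `0`. [folklore] -/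
theorem coeffOp_mul_of_zero {δ : K →ₗ[ℤ] K} (hδ : IsDiffOpLE ℤ 0 δ) (q t : MvPolynomial σ K) :
    coeffOp δ (q * t) = q * coeffOp δ t := by
  induction q using MvPolynomial.induction_on' with
  | monomial m a =>
    rw [show MvPolynomial.monomial m a = MvPolynomial.C a * MvPolynomial.monomial m 1 by
      rw [MvPolynomial.C_mul_monomial, mul_one]]
    have h2 : ∀ u : MvPolynomial σ K, coeffOp (0 : K →ₗ[ℤ] K) u = 0 := by
      intro u
      induction u using MvPolynomial.induction_on' with
      | monomial m' b => rw [coeffOp_monomial, LinearMap.zero_apply, map_zero]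
      | add p q hp hq => rw [map_add, hp, hq, add_zero]
    have h1 := coeffOp_C_mul δ a (MvPolynomial.monomial m (1 : K) * t)
    rw [hδ a, h2, sub_eq_zero] at h1
    rw [mul_assoc, h1, mul_comm (MvPolynomial.monomial m (1:K)) t, coeffOp_mul_monomial_one, mul_assoc,
      mul_comm _ (MvPolynomial.monomial m (1:K))]
  | add p q hp hq => rw [add_mul, map_add, hp, hq, add_mul]

/-- **Coefficient operators keep the order**: `δ ∈ Diff^{≤k}_ℤ(K) ⇒ δ ⊗ id ∈ Diff^{≤k}_ℤ(K[T])`. [EGAIV4 16.8.8;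
folklore] [folklore] -/
theorem IsDiffOpLE.coeffOp : ∀ {k : ℕ} {δ : K →ₗ[ℤ] K}, IsDiffOpLE ℤ k δ → ∀ {σ : Type*}, IsDiffOpLE ℤ k (coeffOp (σ := σ) δ)
  | 0, δ, hδ, σ => by
    intro q
    refine LinearMap.ext fun t => ?_
    rw [commMul_apply, coeffOp_mul_of_zero hδ, sub_self, LinearMap.zero_apply]
  | k + 1, δ, hδ, σ => by
    intro q
    induction q using MvPolynomial.induction_on' with
    | monomial s a =>
      rw [show MvPolynomial.monomial s a = MvPolynomial.C a * MvPolynomial.monomial s 1 by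
        rw [MvPolynomial.C_mul_monomial, mul_one], commMul_mul_right, commMul_coeffOp_C,
        commMul_coeffOp_monomial_one, LinearMap.comp_zero, add_zero]
      have h := (IsDiffOpLE.coeffOp (hδ a) (σ := σ)).comp (isDiffOpLE_mulLeft (R := ℤ) (MvPolynomial.monomial s (1 : K)))
      rwa [add_zero] at h
    | add p q hp hq =>
      rw [commMul_add_right]
      exact hp.add hq

end Coeff

section Chart

variable {R S : Type*} [CommRing R] [CommRing S]

/-! ## §5 Chart algebra (generic target ring, so that only `Monoid.npow` powers occur) -/

/-- The monomial `∏ g_j^{e_j}` (a definition elaborated over a generic ring: its powers are `Monoid.npow`). -/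
def monProd {ι : Type*} [Fintype ι] (g : ι → S) (e : ι → ℕ) : S := ∏ j, g j ^ e j

/-- `φ(∏ c_j^{e_j}) = φ(cᵢ^{|e|}) · ∏_{j ≠ i} g_j^{e_j}` when `φ(c_j) = φ(cᵢ) g_j`, `gᵢ = 1` (the blow-up chart relations).
[folklore; StacksProject 0804] [folklore] -/
theorem map_prod_pow_eq (φ : R →+* S) {d : ℕ} (c : Fin d → R) (i : Fin d) (g : Fin d → S)
    (hg : ∀ j, φ (c j) = φ (c i) * g j) (hgi : g i = 1) (e : Fin d → ℕ) :
    φ (∏ j, c j ^ e j) = φ (c i ^ ∑ j, e j) * monProd (fun j : {j : Fin d // j ≠ i} => g j.1) (fun j => e j.1) := by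
  classical
  rw [map_prod, map_pow]
  have h1 : ∀ j, φ (c j ^ e j) = φ (c i) ^ e j * g j ^ e j := fun j => by
    rw [map_pow, ← mul_pow]
    exact congrArg (fun b => b ^ e j) (hg j)
  simp_rw [h1]
  rw [Finset.prod_mul_distrib, Finset.prod_pow_eq_pow_sum]
  congr 1
  rw [monProd, ← Finset.mul_prod_erase Finset.univ (fun j => g j ^ e j) (Finset.mem_univ i)]
  change g i ^ e i * _ = _
  rw [hgi, one_pow, one_mul]
  exact Finset.prod_subtype (Finset.univ.erase i) (fun j => by simp) (fun j => g j ^ e j)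

/-- `φ(𝔞^{m}) ⊆ (φ(cᵢ^m))` for `𝔞 = (c)` when `φ(𝔞) ⊆ (φ cᵢ)`. [folklore; StacksProject 0804] [folklore] -/
theorem map_pow_span_le (φ : R →+* S) {d : ℕ} (c : Fin d → R) (i : Fin d)
    (hφ : ∀ r ∈ Ideal.span (Set.range c), φ r ∈ Ideal.span {φ (c i)}) (m : ℕ) :
    (Ideal.span (Set.range c) ^ m).map φ ≤ Ideal.span {φ (c i ^ m)} := by
  rw [Ideal.map_pow, map_pow, ← Ideal.span_singleton_pow]
  exact Ideal.pow_right_mono (Ideal.map_le_iff_le_comap.mpr fun r hr => Ideal.mem_comap.mpr (hφ r hr)) m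

/-- The chart relation `φ(∏ c_j^{e_j}) = φ(cᵢ^{|e|}) · ∏_{j≠i} e_j^{e_j}` on `D₊(cᵢ t)`. [folklore; StacksProject
0804] [folklore] -/
theorem chartBase_prod_pow {R : Type u} [CommRing R] {d : ℕ} (c : Fin d → R) (i : Fin d) (e : Fin d → ℕ) {m : ℕ}
    (hm : ∑ j, e j = m) :
    chartBase c i (∏ j, c j ^ e j) =
      chartBase c i (c i ^ m) * monProd (fun j : {j : Fin d // j ≠ i} => chartGen c i j.1) (fun j => e j.1) := by
  subst hm
  exact map_prod_pow_eq (chartBase c i) c i (chartGen c i) (reesChartBase_apply_eq_mul_chartGen c i) (chartGen_self c i) e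

end Chart

end Summit.ResolutionOfSingularities.ResolutionOfSingularities.Theorems.TwistCutClasses
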